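import Literature.Combinatorics.SimpleGraph.GridCells
import Literature.Combinatorics.SimpleGraph.HamiltonianDiamondChain
import Literature.Combinatorics.SimpleGraph.HamiltonianPathCountMap
import Mathlib.Data.List.GetD
import HarnessLib

/-!
# Chains of grid cells: Hamiltonian paths are tuples of cell traversals

The base graph ("skeleton") of the grid-native `#3SAT ≤ #HamPath` construction
(Liśkiewicz–Ogihara–Toda 2003, Lemma 4 / Theorem 7; tree fact
`Literature.Barriers.CriticalPhenomena.GridSAW.LOT2003_lemma4_gadgets`): a **chain of cells** of the types of
`GridCells.lean`, cell `i` consisting of a connector vertex `conn i = 17 i` (of degree two, like the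
connector of the diamond chain of `HamiltonianDiamondChain.lean`) and the block vertices
`vtx i j = 17 i + 1 + j` (`j : Fin 16`), with the cell's edges, the edge `conn i – P_i` and the edge
`Q_i – conn (i+1)` to the next connector. A Hamiltonian path from `s = conn 0` to `t = Q_{n-1}`
traverses the cells in order, each by one of its traversals (`GridCell.CellTy.travs`); this file proves
the decomposition and the resulting count of constrained Hamiltonian paths as a number of tuples of
traversal indices, the input of the substitution theorem of `HamiltonianIteratedSubstitution.lean`
(which is stated for an arbitrary base graph):

* `GridCell.chainG ts`, `chainVerts ts`, `lastQ ts` — the chain of the cell types `ts : List CellTy`;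
* `GridCell.pathOfN ts τ` — the path selecting traversal `τ i` in cell `i`;
* `isHamPathOn_pathOfN`, `exists_eq_pathOfN`, `pathOfN_injective` — **the Hamiltonian `s`–`t` paths
  are exactly the `pathOfN ts τ` with `τ i < ntrav`**, each once;
* `uses_pathOfN_vtx_iff` — which cell edges such a path uses is read off the cell's usage table;
* `hamCountRF_chainG_eq_card` — constrained counts are numbers of tuples.

## References

* M. Liśkiewicz, M. Ogihara, S. Toda, TCS 304 (2003) 129–156, §3–§4.
* M. R. Garey, D. S. Johnson, *Computers and Intractability*, Freeman 1979, §3.2.2.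
-/

namespace Literature.Combinatorics.SimpleGraph

/-! ### Generic lemmas on Hamiltonian vertex lists -/

section generic

variable {α : Type*} [DecidableEq α] {G : _root_.SimpleGraph α}

/-- **Gluing at a cut vertex** (converse of `IsHamPathOn.split`): a Hamiltonian `s`–`x` path of `A`,
the vertex `c`, and a Hamiltonian `y`–`t` path of `B` make a Hamiltonian `s`–`t` path of
`A ⊔ {c} ⊔ B` when `x – c – y`. [folklore] -/
theorem IsHamPathOn.join {V A B : Finset α} {c s t x y : α} {l₁ l₂ : List α}
    (h₁ : IsHamPathOn G A s x l₁) (h₂ : IsHamPathOn G B y t l₂)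
    (hV : ∀ v, v ∈ V ↔ v ∈ A ∨ v = c ∨ v ∈ B) (hAB : Disjoint A B) (hcA : c ∉ A) (hcB : c ∉ B)
    (hxc : G.Adj x c) (hcy : G.Adj c y) : IsHamPathOn G V s t (l₁ ++ c :: l₂) := by
  obtain ⟨hnd₁, hV₁, hs, hx, hc₁⟩ := h₁
  obtain ⟨hnd₂, hV₂, hy, ht, hc₂⟩ := h₂
  have hne₁ : l₁ ≠ [] := by rintro rfl; simp at hs
  obtain ⟨y', r, rfl⟩ : ∃ y' r, l₂ = y' :: r := by
    cases l₂ with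
    | nil => simp at hy
    | cons y' r => exact ⟨y', r, rfl⟩
  simp only [List.head?_cons, Option.some.injEq] at hy
  subst hy
  have hmem₁ : ∀ v, v ∈ l₁ ↔ v ∈ A := fun v => by rw [← List.mem_toFinset, hV₁]
  have hmem₂ : ∀ v, v ∈ y' :: r ↔ v ∈ B := fun v => by rw [← List.mem_toFinset, hV₂]
  refine ⟨?_, ?_, ?_, ?_, ?_⟩
  · rw [List.nodup_append]
    refine ⟨hnd₁, List.nodup_cons.2 ⟨fun h => hcB ((hmem₂ c).1 h), hnd₂⟩, fun a ha b hb => ?_⟩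
    rintro rfl
    rcases List.mem_cons.1 hb with rfl | hb
    · exact hcA ((hmem₁ _).1 ha)
    · exact Finset.disjoint_left.1 hAB ((hmem₁ _).1 ha) ((hmem₂ _).1 hb)
  · ext v
    simp only [List.toFinset_append, List.toFinset_cons, Finset.mem_union, Finset.mem_insert, List.mem_toFinset,
      hmem₁, hV v]
    rw [← hmem₂, List.mem_cons]
  · rw [List.head?_append, hs, Option.some_or]
  · rw [List.getLast?_append, List.getLast?_cons_cons, ht, Option.some_or]
  · rw [List.isChain_append]
    refine ⟨hc₁, List.isChain_cons_cons.2 ⟨hcy, hc₂⟩, fun a ha b hb => ?_⟩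
    simp only [List.head?_cons, Option.mem_def, Option.some.injEq] at hb
    subst hb
    rw [hx, Option.mem_def, Option.some.injEq] at ha
    subst ha
    exact hxc

/-- **Prepending a pendant start**: `c :: l` is a Hamiltonian `c`–`t` path of `insert c B` if `l` is a
Hamiltonian `p`–`t` path of `B`, `c ∉ B` and `c – p`. [folklore] -/
theorem IsHamPathOn.cons {B : Finset α} {c p t : α} {l : List α} (h : IsHamPathOn G B p t l) (hcB : c ∉ B)
    (hcp : G.Adj c p) : IsHamPathOn G (insert c B) c t (c :: l) := by
  obtain ⟨hnd, hV, hp, ht, hc⟩ := h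
  obtain ⟨p', r, rfl⟩ : ∃ p' r, l = p' :: r := by
    cases l with
    | nil => simp at hp
    | cons p' r => exact ⟨p', r, rfl⟩
  simp only [List.head?_cons, Option.some.injEq] at hp
  subst hp
  have hmem : ∀ v, v ∈ p' :: r ↔ v ∈ B := fun v => by rw [← List.mem_toFinset, hV]
  refine ⟨List.nodup_cons.2 ⟨fun h => hcB ((hmem c).1 h), hnd⟩, ?_, rfl, ?_, List.isChain_cons_cons.2 ⟨hcp, hc⟩⟩
  · rw [List.toFinset_cons, hV]
  · rw [List.getLast?_cons_cons]; exact ht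

/-- **Removing a pendant start**: if the start `s ≠ t` of a Hamiltonian path has only the neighbour `p`
in `V`, the path is `s` followed by a Hamiltonian `p`–`t` path of `V` without `s`. [folklore] -/
theorem IsHamPathOn.exists_eq_cons {V : Finset α} {s t p : α} {l : List α} (h : IsHamPathOn G V s t l)
    (hst : s ≠ t) (hp : ∀ y ∈ V, G.Adj s y → y = p) :
    ∃ l', l = s :: l' ∧ IsHamPathOn G (V.erase s) p t l' := by
  obtain ⟨hnd, hV, hs, ht, hc⟩ := h
  obtain ⟨l', rfl⟩ : ∃ l', l = s :: l' := by
    cases l with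
    | nil => simp at hs
    | cons a l' =>
      simp only [List.head?_cons, Option.some.injEq] at hs
      exact ⟨l', by rw [hs]⟩
  obtain ⟨b, r, rfl⟩ : ∃ b r, l' = b :: r := by
    cases l' with
    | nil =>
      simp only [List.getLast?_singleton, Option.some.injEq] at ht
      exact absurd ht hst
    | cons b r => exact ⟨b, r, rfl⟩
  have hmemV : ∀ v, v ∈ s :: b :: r ↔ v ∈ V := fun v => by rw [← List.mem_toFinset, hV]
  have hb : b = p := hp b ((hmemV b).1 (by simp)) (List.isChain_cons_cons.1 hc).1
  subst hb
  refine ⟨b :: r, rfl, (List.nodup_cons.1 hnd).2, ?_, rfl, ?_, (List.isChain_cons_cons.1 hc).2⟩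
  · have h1 : (s :: b :: r).toFinset = insert s (b :: r).toFinset := List.toFinset_cons
    rw [← hV, h1, Finset.erase_insert]
    rw [List.mem_toFinset]
    exact (List.nodup_cons.1 hnd).1
  · rw [List.getLast?_cons_cons] at ht; exact ht

omit [DecidableEq α] in
/-- Infixes of length two of `A ++ B ++ C` avoiding `A` and `C` are infixes of `B`. [folklore] -/
theorem pair_infix_inner_iff {A B C : List α} {u v : α} (hu : u ∉ A ∧ u ∉ C) (hv : v ∉ A ∧ v ∉ C) :
    [u, v] <:+: A ++ B ++ C ↔ [u, v] <:+: B := by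
  constructor
  · intro h
    rw [pair_infix_iff] at h ⊢
    obtain ⟨i, hi, h1, h2⟩ := h
    have hlen : (A ++ B ++ C).length = A.length + B.length + C.length := by
      simp only [List.length_append]
    have hiA : A.length ≤ i := by
      rcases Nat.lt_or_ge i A.length with hlt | hge
      · have : (A ++ B ++ C)[i] = A[i] := by
          rw [List.getElem_append_left (by rw [List.length_append]; omega), List.getElem_append_left hlt]
        exact absurd (by rw [← h1, this]; exact List.getElem_mem _) hu.1
      · exact hge
    have hiC : i + 1 < A.length + B.length := by
      rcases Nat.lt_or_ge (i + 1) (A.length + B.length) with hlt | hge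
      · exact hlt
      · have h' : (A ++ B ++ C)[i + 1] = C[i + 1 - (A.length + B.length)]'(by rw [hlen] at hi; omega) := by
          rw [List.getElem_append_right (by rw [List.length_append]; omega)]
          simp only [List.length_append]
        exact absurd (by rw [← h2, h']; exact List.getElem_mem _) hv.2
    refine ⟨i - A.length, by omega, ?_, ?_⟩
    · rw [← h1, List.getElem_append_left (by rw [List.length_append]; omega), List.getElem_append_right hiA]
    · rw [← h2, List.getElem_append_left (by rw [List.length_append]; omega), List.getElem_append_right (by omega)]
      congr 1; omega
  · intro h
    exact h.trans (List.infix_append A B C)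

end generic


namespace GridCell

open CellTy

/-! ### Numbering -/

/-- The connector vertex of cell `i`. [folklore] -/
def conn (i : ℕ) : ℕ := 17 * i

/-- The block vertex `j` of cell `i`. [folklore] -/
def vtx (i : ℕ) (j : Fin 16) : ℕ := 17 * i + 1 + j.val

/-- Cell index of a block vertex. [folklore] -/
theorem vtx_div (i : ℕ) (j : Fin 16) : vtx i j / 17 = i := by unfold vtx; omega

/-- Offset of a block vertex. [folklore] -/
theorem vtx_mod (i : ℕ) (j : Fin 16) : vtx i j % 17 = j.val + 1 := by unfold vtx; omega

/-- Cell index of a connector. [folklore] -/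
theorem conn_div (i : ℕ) : conn i / 17 = i := by unfold conn; omega

/-- Offset of a connector. [folklore] -/
theorem conn_mod (i : ℕ) : conn i % 17 = 0 := by unfold conn; omega

/-- Block vertices are not connectors. [folklore] -/
theorem vtx_ne_conn (i i' : ℕ) (j : Fin 16) : vtx i j ≠ conn i' := by unfold vtx conn; omega

/-- `vtx` is injective in both arguments. [folklore] -/
theorem vtx_inj {i i' : ℕ} {a b : Fin 16} : vtx i a = vtx i' b ↔ i = i' ∧ a = b := by
  constructor
  · intro h
    have h1 := congrArg (· / 17) h
    have h2 := congrArg (· % 17) h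
    simp only [vtx_div, vtx_mod] at h1 h2
    exact ⟨h1, Fin.ext (by omega)⟩
  · rintro ⟨rfl, rfl⟩; rfl

/-- `vtx i` is injective. [folklore] -/
theorem vtx_injective (i : ℕ) : Function.Injective (vtx i) := fun _ _ h => (vtx_inj.1 h).2

/-- `conn` is injective. [folklore] -/
theorem conn_inj {i i' : ℕ} : conn i = conn i' ↔ i = i' := by unfold conn; omega

/-- The embedding of the local vertices of cell `i`. [folklore] -/
def vtxEmb (i : ℕ) : Fin 16 ↪ ℕ := ⟨vtx i, vtx_injective i⟩

/-- The type of cell `i` of the chain `ts` (default `bead` beyond the end). [folklore] -/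
def cellTy (ts : List CellTy) (i : ℕ) : CellTy := ts.getD i .bead

/-- Appending a cell does not change the earlier types. [folklore] -/
theorem cellTy_append_left {ts : List CellTy} {ty : CellTy} {i : ℕ} (hi : i < ts.length) :
    cellTy (ts ++ [ty]) i = cellTy ts i := by
  simp only [cellTy, List.getD_eq_getElem?_getD, List.getElem?_append_left hi]

/-- The appended cell has the appended type. [folklore] -/
theorem cellTy_append_length (ts : List CellTy) (ty : CellTy) : cellTy (ts ++ [ty]) ts.length = ty := by
  simp [cellTy, List.getD_eq_getElem?_getD]

/-- The type of cell `i < n`, as a list entry. [folklore] -/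
theorem cellTy_eq_getElem {ts : List CellTy} {i : ℕ} (hi : i < ts.length) : cellTy ts i = ts[i] := by
  simp [cellTy, List.getD_eq_getElem?_getD, List.getElem?_eq_getElem hi]

/-! ### The chain graph -/

/-- **The directed edge relation of the chain** of the cell types `ts`: cell edges, connector to `P`,
`Q` to the next connector. [folklore] -/
def Rel (ts : List CellTy) (u v : ℕ) : Prop :=
  (∃ i < ts.length, ∃ a b : Fin 16, (cellTy ts i).adjB a b = true ∧ u = vtx i a ∧ v = vtx i b) ∨
  (∃ i < ts.length, u = conn i ∧ v = vtx i (cellTy ts i).pIdx) ∨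
  (∃ i, i + 1 < ts.length ∧ u = vtx i (cellTy ts i).qIdx ∧ v = conn (i + 1))

/-- **The chain of cells.** [folklore] -/
def chainG (ts : List CellTy) : _root_.SimpleGraph ℕ :=
  _root_.SimpleGraph.fromRel (Rel ts)

/-- Adjacency in the chain, unfolded. [folklore] -/
theorem chainG_adj {ts : List CellTy} {u v : ℕ} : (chainG ts).Adj u v ↔ u ≠ v ∧ (Rel ts u v ∨ Rel ts v u) :=
  _root_.SimpleGraph.fromRel_adj _ _ _

/-- The block vertices of a cell of type `ty` placed as cell `i`. [folklore] -/
def blockVerts (ty : CellTy) (i : ℕ) : Finset ℕ := ty.verts.image (vtx i)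

/-- **The vertices of the chain.** [folklore] -/
def chainVerts (ts : List CellTy) : Finset ℕ :=
  (Finset.range ts.length).biUnion fun i => insert (conn i) (blockVerts (cellTy ts i) i)

/-- The exit corner of the last cell (the end of the Hamiltonian paths). [folklore] -/
def lastQ (ts : List CellTy) : ℕ := vtx (ts.length - 1) (cellTy ts (ts.length - 1)).qIdx

/-- Membership in a block. [folklore] -/
theorem mem_blockVerts {ty : CellTy} {i v : ℕ} : v ∈ blockVerts ty i ↔ ∃ j ∈ ty.vertList, vtx i j = v := by
  simp [blockVerts, CellTy.verts]

/-- A block vertex lies in a block iff the indices agree and the local vertex is listed. [folklore] -/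
theorem vtx_mem_blockVerts_iff {ty : CellTy} {i i' : ℕ} {j : Fin 16} : vtx i j ∈ blockVerts ty i' ↔ i = i' ∧ j ∈ ty.vertList := by
  rw [mem_blockVerts]
  constructor
  · rintro ⟨j', hj', h⟩
    obtain ⟨rfl, rfl⟩ := vtx_inj.1 h
    exact ⟨rfl, hj'⟩
  · rintro ⟨rfl, hj⟩
    exact ⟨j, hj, rfl⟩

/-- Connectors are not block vertices. [folklore] -/
theorem conn_not_mem_blockVerts (ty : CellTy) (i i' : ℕ) : conn i ∉ blockVerts ty i' := by
  rw [mem_blockVerts]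
  rintro ⟨j, -, h⟩
  exact vtx_ne_conn _ _ _ h

/-- Membership in the chain's vertex set. [folklore] -/
theorem mem_chainVerts {ts : List CellTy} {v : ℕ} :
    v ∈ chainVerts ts ↔ ∃ i < ts.length, v = conn i ∨ v ∈ blockVerts (cellTy ts i) i := by
  simp [chainVerts]

/-- Connectors of cells are chain vertices. [folklore] -/
theorem conn_mem_chainVerts {ts : List CellTy} {i : ℕ} (hi : i < ts.length) : conn i ∈ chainVerts ts :=
  mem_chainVerts.2 ⟨i, hi, Or.inl rfl⟩

/-- A connector is a chain vertex iff its index is below the length. [folklore] -/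
theorem conn_mem_chainVerts_iff {ts : List CellTy} {i : ℕ} : conn i ∈ chainVerts ts ↔ i < ts.length := by
  refine ⟨fun h => ?_, conn_mem_chainVerts⟩
  obtain ⟨i', hi', h | h⟩ := mem_chainVerts.1 h
  · rwa [conn_inj.1 h]
  · exact absurd h (conn_not_mem_blockVerts _ _ _)

/-- A block vertex is a chain vertex iff its cell index is below the length and it is listed. [folklore] -/
theorem vtx_mem_chainVerts_iff {ts : List CellTy} {i : ℕ} {j : Fin 16} :
    vtx i j ∈ chainVerts ts ↔ i < ts.length ∧ j ∈ (cellTy ts i).vertList := by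
  rw [mem_chainVerts]
  constructor
  · rintro ⟨i', hi', h | h⟩
    · exact absurd h (vtx_ne_conn _ _ _)
    · obtain ⟨rfl, hj⟩ := vtx_mem_blockVerts_iff.1 h
      exact ⟨hi', hj⟩
  · rintro ⟨hi, hj⟩
    exact ⟨i, hi, Or.inr (vtx_mem_blockVerts_iff.2 ⟨rfl, hj⟩)⟩

/-- Every chain vertex is a connector or a block vertex of a cell below the length. [folklore] -/
theorem eq_conn_or_eq_vtx_of_mem {ts : List CellTy} {v : ℕ} (hv : v ∈ chainVerts ts) :
    ∃ i < ts.length, v = conn i ∨ ∃ j ∈ (cellTy ts i).vertList, v = vtx i j := by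
  obtain ⟨i, hi, h | h⟩ := mem_chainVerts.1 hv
  · exact ⟨i, hi, Or.inl h⟩
  · obtain ⟨j, hj, rfl⟩ := mem_blockVerts.1 h
    exact ⟨i, hi, Or.inr ⟨j, hj, rfl⟩⟩

/-- Appending a cell adds its connector and block. [folklore] -/
theorem mem_chainVerts_append {ts : List CellTy} {ty : CellTy} {v : ℕ} :
    v ∈ chainVerts (ts ++ [ty]) ↔ v ∈ chainVerts ts ∨ v = conn ts.length ∨ v ∈ blockVerts ty ts.length := by
  rw [mem_chainVerts, mem_chainVerts]
  constructor
  · rintro ⟨i, hi, h⟩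
    rw [List.length_append, List.length_singleton] at hi
    rcases Nat.lt_or_ge i ts.length with hlt | hge
    · rw [cellTy_append_left hlt] at h
      exact Or.inl ⟨i, hlt, h⟩
    · obtain rfl : i = ts.length := by omega
      rw [cellTy_append_length] at h
      exact Or.inr h
  · rintro (⟨i, hi, h⟩ | h)
    · exact ⟨i, by rw [List.length_append]; omega, by rwa [cellTy_append_left hi]⟩
    · exact ⟨ts.length, by simp, by rwa [cellTy_append_length]⟩

/-! ### Edges of the chain, read off the relation -/

/-- The edge from a connector to the entry corner of its cell. [folklore] -/
theorem adj_conn_pIdx {ts : List CellTy} {i : ℕ} (hi : i < ts.length) :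
    (chainG ts).Adj (conn i) (vtx i (cellTy ts i).pIdx) :=
  chainG_adj.2 ⟨(vtx_ne_conn _ _ _).symm, Or.inl (Or.inr (Or.inl ⟨i, hi, rfl, rfl⟩))⟩

/-- The edge from the exit corner of a cell to the next connector. [folklore] -/
theorem adj_qIdx_conn {ts : List CellTy} {i : ℕ} (hi : i + 1 < ts.length) :
    (chainG ts).Adj (vtx i (cellTy ts i).qIdx) (conn (i + 1)) :=
  chainG_adj.2 ⟨vtx_ne_conn _ _ _, Or.inl (Or.inr (Or.inr ⟨i, hi, rfl, rfl⟩))⟩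

/-- Cell edges are chain edges. [folklore] -/
theorem adj_vtx_vtx {ts : List CellTy} {i : ℕ} (hi : i < ts.length) {a b : Fin 16}
    (h : (cellTy ts i).adjB a b = true) : (chainG ts).Adj (vtx i a) (vtx i b) := by
  refine chainG_adj.2 ⟨fun hab => ?_, Or.inl (Or.inl ⟨i, hi, a, b, h, rfl, rfl⟩)⟩
  rw [(vtx_inj.1 hab).2, CellTy.adjB_irrefl] at h
  exact Bool.false_ne_true h

/-- The relation between two block vertices is a cell edge of a common cell. [folklore] -/
theorem rel_vtx_vtx_iff {ts : List CellTy} {i i' : ℕ} {a b : Fin 16} :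
    Rel ts (vtx i a) (vtx i' b) ↔ i = i' ∧ i < ts.length ∧ (cellTy ts i).adjB a b = true := by
  constructor
  · rintro (⟨k, hk, a', b', h, h1, h2⟩ | ⟨k, -, h1, -⟩ | ⟨k, -, -, h2⟩)
    · obtain ⟨rfl, rfl⟩ := vtx_inj.1 h1
      obtain ⟨rfl, rfl⟩ := vtx_inj.1 h2
      exact ⟨rfl, hk, h⟩
    · exact absurd h1 (vtx_ne_conn _ _ _)
    · exact absurd h2 (vtx_ne_conn _ _ _)
  · rintro ⟨rfl, hi, h⟩
    exact Or.inl ⟨i, hi, a, b, h, rfl, rfl⟩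

/-- **Adjacency of block vertices is cell adjacency** (within one cell; none across cells). [folklore] -/
theorem adj_vtx_vtx_iff {ts : List CellTy} {i i' : ℕ} {a b : Fin 16} :
    (chainG ts).Adj (vtx i a) (vtx i' b) ↔ i = i' ∧ i < ts.length ∧ (cellTy ts i).adjB a b = true := by
  rw [chainG_adj, rel_vtx_vtx_iff, rel_vtx_vtx_iff]
  constructor
  · rintro ⟨-, h | ⟨rfl, hi, h⟩⟩
    · exact h
    · exact ⟨rfl, hi, by rwa [CellTy.adjB_symm]⟩
  · rintro ⟨rfl, hi, h⟩
    refine ⟨fun hab => ?_, Or.inl ⟨rfl, hi, h⟩⟩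
    rw [(vtx_inj.1 hab).2, CellTy.adjB_irrefl] at h
    exact Bool.false_ne_true h

/-- The relation from a connector. [folklore] -/
theorem rel_conn_left_iff {ts : List CellTy} {i v : ℕ} :
    Rel ts (conn i) v ↔ i < ts.length ∧ v = vtx i (cellTy ts i).pIdx := by
  constructor
  · rintro (⟨k, -, a', b', -, h1, -⟩ | ⟨k, hk, h1, h2⟩ | ⟨k, -, h1, -⟩)
    · exact absurd h1.symm (vtx_ne_conn _ _ _)
    · obtain rfl := conn_inj.1 h1
      exact ⟨hk, h2⟩
    · exact absurd h1.symm (vtx_ne_conn _ _ _)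
  · rintro ⟨hi, rfl⟩
    exact Or.inr (Or.inl ⟨i, hi, rfl, rfl⟩)

/-- The relation into a connector. [folklore] -/
theorem rel_conn_right_iff {ts : List CellTy} {i u : ℕ} :
    Rel ts u (conn i) ↔ 0 < i ∧ i < ts.length ∧ u = vtx (i - 1) (cellTy ts (i - 1)).qIdx := by
  constructor
  · rintro (⟨k, -, a', b', -, -, h2⟩ | ⟨k, -, -, h2⟩ | ⟨k, hk, h1, h2⟩)
    · exact absurd h2.symm (vtx_ne_conn _ _ _)
    · exact absurd h2.symm (vtx_ne_conn _ _ _)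
    · obtain rfl := conn_inj.1 h2
      exact ⟨Nat.succ_pos k, hk, by simpa using h1⟩
  · rintro ⟨hpos, hi, rfl⟩
    refine Or.inr (Or.inr ⟨i - 1, by omega, rfl, ?_⟩)
    congr 1; omega

/-- **The neighbours of a connector**: the entry corner of its cell and the exit corner of the previous
cell. [folklore] -/
theorem adj_conn_iff {ts : List CellTy} {i v : ℕ} :
    (chainG ts).Adj (conn i) v ↔
      (i < ts.length ∧ v = vtx i (cellTy ts i).pIdx) ∨ (0 < i ∧ i < ts.length ∧ v = vtx (i - 1) (cellTy ts (i - 1)).qIdx) := by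
  rw [chainG_adj, rel_conn_left_iff, rel_conn_right_iff]
  constructor
  · rintro ⟨-, h | h⟩
    exacts [Or.inl h, Or.inr h]
  · rintro (h | h)
    · exact ⟨by rw [h.2]; exact (vtx_ne_conn _ _ _).symm, Or.inl h⟩
    · exact ⟨by rw [h.2.2]; exact (vtx_ne_conn _ _ _).symm, Or.inr h⟩

/-- A block vertex adjacent to a connector is an entry or exit corner. [folklore] -/
theorem adj_vtx_conn_iff {ts : List CellTy} {i i' : ℕ} {j : Fin 16} :
    (chainG ts).Adj (vtx i j) (conn i') ↔
      (i' = i ∧ i < ts.length ∧ j = (cellTy ts i).pIdx) ∨ (i' = i + 1 ∧ i + 1 < ts.length ∧ j = (cellTy ts i).qIdx) := by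
  rw [(chainG ts).adj_comm, adj_conn_iff]
  constructor
  · rintro (⟨hi, h⟩ | ⟨hpos, hi, h⟩)
    · obtain ⟨rfl, rfl⟩ := vtx_inj.1 h
      exact Or.inl ⟨rfl, hi, rfl⟩
    · obtain ⟨rfl, rfl⟩ := vtx_inj.1 h
      refine Or.inr ⟨by omega, by omega, ?_⟩
      rfl
  · rintro (⟨rfl, hi, rfl⟩ | ⟨rfl, hi, rfl⟩)
    · exact Or.inl ⟨hi, rfl⟩
    · exact Or.inr ⟨Nat.succ_pos i, hi, by simp⟩

/-- Connectors are not adjacent to connectors. [folklore] -/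
theorem not_adj_conn_conn {ts : List CellTy} (i i' : ℕ) : ¬ (chainG ts).Adj (conn i) (conn i') := by
  rw [adj_conn_iff]
  rintro (⟨-, h⟩ | ⟨-, -, h⟩) <;> exact vtx_ne_conn _ _ _ h.symm

/-- Adjacent vertices of the chain are chain vertices. [folklore] -/
theorem mem_chainVerts_of_rel {ts : List CellTy} {u v : ℕ} (h : Rel ts u v) : u ∈ chainVerts ts ∧ v ∈ chainVerts ts := by
  rcases h with ⟨i, hi, a, b, hab, rfl, rfl⟩ | ⟨i, hi, rfl, rfl⟩ | ⟨i, hi, rfl, rfl⟩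
  · have := (cellTy ts i).mem_vertList_of_adjB a b hab
    exact ⟨vtx_mem_chainVerts_iff.2 ⟨hi, this.1⟩, vtx_mem_chainVerts_iff.2 ⟨hi, this.2⟩⟩
  · exact ⟨conn_mem_chainVerts hi, vtx_mem_chainVerts_iff.2 ⟨hi, (cellTy ts i).pIdx_mem.1⟩⟩
  · exact ⟨vtx_mem_chainVerts_iff.2 ⟨by omega, (cellTy ts i).pIdx_mem.2⟩, conn_mem_chainVerts hi⟩

/-- Adjacent vertices of the chain are chain vertices. [folklore] -/
theorem mem_chainVerts_of_adj {ts : List CellTy} {u v : ℕ} (h : (chainG ts).Adj u v) : u ∈ chainVerts ts ∧ v ∈ chainVerts ts := by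
  obtain ⟨-, h | h⟩ := chainG_adj.1 h
  · exact mem_chainVerts_of_rel h
  · exact (mem_chainVerts_of_rel h).symm

/-- **Appending a cell does not change adjacency between the old vertices.** [folklore] -/
theorem rel_append_iff_of_mem {ts : List CellTy} {ty : CellTy} {u v : ℕ} (hu : u ∈ chainVerts ts) (hv : v ∈ chainVerts ts) :
    Rel (ts ++ [ty]) u v ↔ Rel ts u v := by
  have hn : ts.length < (ts ++ [ty]).length := by simp
  constructor
  · rintro (⟨i, hi, a, b, hab, rfl, rfl⟩ | ⟨i, hi, rfl, rfl⟩ | ⟨i, hi, rfl, rfl⟩)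
    · have hi' : i < ts.length := (vtx_mem_chainVerts_iff.1 hu).1
      rw [cellTy_append_left hi'] at hab
      exact Or.inl ⟨i, hi', a, b, hab, rfl, rfl⟩
    · have hi' : i < ts.length := conn_mem_chainVerts_iff.1 hu
      rw [cellTy_append_left hi']
      exact Or.inr (Or.inl ⟨i, hi', rfl, rfl⟩)
    · have hi' : i + 1 < ts.length := conn_mem_chainVerts_iff.1 hv
      rw [cellTy_append_left (by omega)]
      exact Or.inr (Or.inr ⟨i, hi', rfl, rfl⟩)
  · rintro (⟨i, hi, a, b, hab, rfl, rfl⟩ | ⟨i, hi, rfl, rfl⟩ | ⟨i, hi, rfl, rfl⟩)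
    · exact Or.inl ⟨i, by omega, a, b, by rwa [cellTy_append_left hi], rfl, rfl⟩
    · refine Or.inr (Or.inl ⟨i, by omega, rfl, ?_⟩); rw [cellTy_append_left hi]
    · refine Or.inr (Or.inr ⟨i, by rw [List.length_append]; omega, ?_, rfl⟩); rw [cellTy_append_left (by omega)]

/-- **Appending a cell does not change adjacency between the old vertices.** [folklore] -/
theorem adj_append_iff_of_mem {ts : List CellTy} {ty : CellTy} {u v : ℕ} (hu : u ∈ chainVerts ts) (hv : v ∈ chainVerts ts) :
    (chainG (ts ++ [ty])).Adj u v ↔ (chainG ts).Adj u v := by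
  rw [chainG_adj, chainG_adj, rel_append_iff_of_mem hu hv, rel_append_iff_of_mem hv hu]

/-- **Inside a block, the chain is the relabelled cell graph.** [folklore] -/
theorem adj_iff_map_adj_of_mem_block {ts : List CellTy} {i : ℕ} (hi : i < ts.length) {u v : ℕ}
    (hu : u ∈ blockVerts (cellTy ts i) i) (hv : v ∈ blockVerts (cellTy ts i) i) :
    (chainG ts).Adj u v ↔ ((cellTy ts i).graph.map (vtxEmb i)).Adj u v := by
  obtain ⟨a, -, rfl⟩ := mem_blockVerts.1 hu
  obtain ⟨b, -, rfl⟩ := mem_blockVerts.1 hv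
  rw [adj_vtx_vtx_iff, _root_.SimpleGraph.map_adj]
  constructor
  · rintro ⟨-, -, h⟩
    exact ⟨a, b, ((cellTy ts i).graph_adj a b).2 h, rfl, rfl⟩
  · rintro ⟨a', b', h, ha, hb⟩
    obtain rfl : a' = a := vtx_injective i ha
    obtain rfl : b' = b := vtx_injective i hb
    exact ⟨rfl, hi, ((cellTy ts i).graph_adj a' b').1 h⟩

/-! ### The canonical paths -/

/-- The segment of cell `i` traversed by traversal `k`: the connector, then the traversal relabelled.
[folklore] -/
def segment (ty : CellTy) (i k : ℕ) : List ℕ := conn i :: (ty.travs.getD k []).map (vtx i)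

/-- **The path of the traversal-index vector `τ`.** [folklore] -/
def pathOfN (ts : List CellTy) (τ : ℕ → ℕ) : List ℕ :=
  ((List.range ts.length).map fun i => segment (cellTy ts i) i (τ i)).flatten

/-- The empty chain has the empty path. [folklore] -/
theorem pathOfN_nil (τ : ℕ → ℕ) : pathOfN [] τ = [] := rfl

/-- Appending a cell appends its segment. [folklore] -/
theorem pathOfN_append (ts : List CellTy) (ty : CellTy) (τ : ℕ → ℕ) :
    pathOfN (ts ++ [ty]) τ = pathOfN ts τ ++ segment ty ts.length (τ ts.length) := by
  unfold pathOfN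
  rw [List.length_append, List.length_singleton, List.range_succ, List.map_append, List.flatten_append,
    List.map_singleton, List.flatten_singleton, cellTy_append_length]
  congr 2
  refine List.map_congr_left fun i hi => ?_
  rw [cellTy_append_left (List.mem_range.1 hi)]

/-- `pathOfN` depends only on the indices below the length. [folklore] -/
theorem pathOfN_congr {ts : List CellTy} {τ τ' : ℕ → ℕ} (h : ∀ i < ts.length, τ i = τ' i) : pathOfN ts τ = pathOfN ts τ' := by
  unfold pathOfN
  congr 1
  refine List.map_congr_left fun i hi => ?_
  rw [h i (List.mem_range.1 hi)]

/-- A valid traversal index selects a member of the traversal list. [folklore] -/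
theorem getD_mem_travs {ty : CellTy} {k : ℕ} (hk : k < ty.ntrav) : ty.travs.getD k [] ∈ ty.travs := by
  rw [List.getD_eq_getElem _ _ (by rw [ty.length_travs]; exact hk)]
  exact List.getElem_mem _

/-- The `k`-th traversal as a default lookup. [folklore] -/
theorem trav_eq_getD (ty : CellTy) (k : Fin ty.ntrav) : ty.trav k = ty.travs.getD k.val [] := by
  rw [List.getD_eq_getElem _ _ (by rw [ty.length_travs]; exact k.isLt)]
  simp [CellTy.trav]

/-- **A traversal of cell `i`, relabelled, is a Hamiltonian path of its block in the chain.** [folklore] -/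
theorem isHamPathOn_block {ts : List CellTy} {i : ℕ} (hi : i < ts.length) {k : ℕ} (hk : k < (cellTy ts i).ntrav) :
    IsHamPathOn (chainG ts) (blockVerts (cellTy ts i) i) (vtx i (cellTy ts i).pIdx) (vtx i (cellTy ts i).qIdx)
      (((cellTy ts i).travs.getD k []).map (vtx i)) := by
  have h := ((cellTy ts i).isHamPathOn_iff_mem_travs _).2 (getD_mem_travs hk)
  exact h.map (vtx_injective i) (G' := chainG ts) fun a b hab => adj_vtx_vtx hi (((cellTy ts i).graph_adj a b).1 hab)

/-- **The segment of cell `i` is a Hamiltonian path of connector plus block.** [folklore] -/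
theorem isHamPathOn_segment {ts : List CellTy} {i : ℕ} (hi : i < ts.length) {k : ℕ} (hk : k < (cellTy ts i).ntrav) :
    IsHamPathOn (chainG ts) (insert (conn i) (blockVerts (cellTy ts i) i)) (conn i) (vtx i (cellTy ts i).qIdx)
      (segment (cellTy ts i) i k) :=
  (isHamPathOn_block hi hk).cons (conn_not_mem_blockVerts _ _ _) (adj_conn_pIdx hi)

/-- The vertex set of a one-cell chain. [folklore] -/
theorem chainVerts_singleton (ty : CellTy) : chainVerts [ty] = insert (conn 0) (blockVerts ty 0) := by
  ext v
  rw [mem_chainVerts]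
  simp only [List.length_singleton, Nat.lt_one_iff, exists_eq_left, Finset.mem_insert]
  rfl

/-- The block of a new cell is disjoint from the old chain. [folklore] -/
theorem disjoint_chainVerts_blockVerts (ts : List CellTy) (ty : CellTy) : Disjoint (chainVerts ts) (blockVerts ty ts.length) := by
  rw [Finset.disjoint_right]
  intro v hv hv'
  obtain ⟨j, -, rfl⟩ := mem_blockVerts.1 hv
  exact absurd (vtx_mem_chainVerts_iff.1 hv').1 (lt_irrefl _)

/-- There is no edge between the old chain and the block of an appended cell (they meet only through
the new connector). [folklore] -/
theorem not_adj_chainVerts_blockVerts {ts : List CellTy} {ty : CellTy} {a b : ℕ} (ha : a ∈ chainVerts ts)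
    (hb : b ∈ blockVerts ty ts.length) : ¬ (chainG (ts ++ [ty])).Adj a b := by
  obtain ⟨j, -, rfl⟩ := mem_blockVerts.1 hb
  obtain ⟨i, hi, rfl | ⟨j', -, rfl⟩⟩ := eq_conn_or_eq_vtx_of_mem ha
  · rw [adj_conn_iff]
    rintro (⟨-, h⟩ | ⟨-, -, h⟩)
    · exact absurd (vtx_inj.1 h).1 (by omega)
    · exact absurd (vtx_inj.1 h).1 (by omega)
  · rw [adj_vtx_vtx_iff]
    rintro ⟨h, -⟩
    omega

/-- `lastQ` of an extended chain with a nonempty prefix, seen from the prefix. [folklore] -/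
theorem lastQ_eq_of_ne_nil {ts : List CellTy} (_hts : ts ≠ []) :
    lastQ ts = vtx (ts.length - 1) (cellTy ts (ts.length - 1)).qIdx := rfl

/-- **The canonical paths are Hamiltonian `s`–`t` paths of the chain.** [folklore] -/
theorem isHamPathOn_pathOfN : ∀ (ts : List CellTy), ts ≠ [] → ∀ (τ : ℕ → ℕ), (∀ i < ts.length, τ i < (cellTy ts i).ntrav) →
    IsHamPathOn (chainG ts) (chainVerts ts) (conn 0) (lastQ ts) (pathOfN ts τ) := by
  intro ts
  induction ts using List.reverseRecOn with
  | nil => intro h; exact absurd rfl h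
  | append_singleton ts' ty ih =>
    intro _ τ hτ
    have hn : (ts' ++ [ty]).length = ts'.length + 1 := by simp
    have hty : cellTy (ts' ++ [ty]) ts'.length = ty := cellTy_append_length ts' ty
    have hτn : τ ts'.length < ty.ntrav := by
      have := hτ ts'.length (by simp)
      rwa [hty] at this
    have hlast : lastQ (ts' ++ [ty]) = vtx ts'.length ty.qIdx := by
      simp only [lastQ, hn, Nat.add_sub_cancel, hty]
    rw [pathOfN_append, hlast]
    rcases eq_or_ne ts' [] with rfl | hne
    · -- a single cell
      rw [pathOfN_nil, List.nil_append]
      simp only [List.nil_append, List.length_nil, chainVerts_singleton]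
      have h := isHamPathOn_segment (ts := [ty]) (i := 0) (by simp) (k := τ 0) (by simpa [cellTy_eq_getElem] using hτn)
      simpa [cellTy_eq_getElem] using h
    · -- join the old path and the new segment at the new connector
      have hih := ih hne τ fun i hi => by
        have := hτ i (by rw [hn]; omega)
        rwa [cellTy_append_left hi] at this
      have h₁ : IsHamPathOn (chainG (ts' ++ [ty])) (chainVerts ts') (conn 0) (lastQ ts') (pathOfN ts' τ) :=
        hih.mono fun a ha b hb hab => (adj_append_iff_of_mem ha hb).2 hab
      have h₂ := isHamPathOn_block (ts := ts' ++ [ty]) (i := ts'.length) (by simp) (k := τ ts'.length) (by rwa [hty])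
      rw [hty] at h₂
      have hpos : 0 < ts'.length := List.length_pos_of_ne_nil hne
      refine h₁.join h₂ (fun v => mem_chainVerts_append) (disjoint_chainVerts_blockVerts ts' ty)
        (fun h => absurd (conn_mem_chainVerts_iff.1 h) (lt_irrefl _)) (conn_not_mem_blockVerts _ _ _) ?_ ?_
      · rw [lastQ_eq_of_ne_nil hne]
        have := adj_qIdx_conn (ts := ts' ++ [ty]) (i := ts'.length - 1) (by rw [hn]; omega)
        rwa [Nat.sub_add_cancel hpos, cellTy_append_left (by omega)] at this
      · have := adj_conn_pIdx (ts := ts' ++ [ty]) (i := ts'.length) (by simp)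
        rwa [hty] at this

/-- **A Hamiltonian path of a block of the chain is a relabelled traversal.** [folklore] -/
theorem exists_eq_map_getD_of_block {ts : List CellTy} {i : ℕ} (hi : i < ts.length) {l : List ℕ}
    (h : IsHamPathOn (chainG ts) (blockVerts (cellTy ts i) i) (vtx i (cellTy ts i).pIdx) (vtx i (cellTy ts i).qIdx) l) :
    ∃ k < (cellTy ts i).ntrav, l = ((cellTy ts i).travs.getD k []).map (vtx i) := by
  set ty := cellTy ts i with hty
  have h' : IsHamPathOn (ty.graph.map (vtxEmb i)) (ty.verts.map (vtxEmb i)) (vtxEmb i ty.pIdx) (vtxEmb i ty.qIdx) l := by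
    rw [Finset.map_eq_image]
    exact h.mono fun a ha b hb hab => (adj_iff_map_adj_of_mem_block hi ha hb).1 hab
  obtain ⟨l', rfl, hl'⟩ := h'.exists_eq_map (vtxEmb i)
  obtain ⟨k, hk⟩ := (ty.mem_travs_iff l').1 ((ty.isHamPathOn_iff_mem_travs l').1 hl')
  refine ⟨k.val, k.isLt, ?_⟩
  rw [← trav_eq_getD, hk]
  rfl

/-- **Every Hamiltonian `s`–`t` path of the chain is a canonical path.** [folklore] -/
theorem exists_eq_pathOfN : ∀ (ts : List CellTy) {l : List ℕ},
    IsHamPathOn (chainG ts) (chainVerts ts) (conn 0) (lastQ ts) l →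
      ∃ τ : ℕ → ℕ, (∀ i < ts.length, τ i < (cellTy ts i).ntrav) ∧ l = pathOfN ts τ := by
  intro ts
  induction ts using List.reverseRecOn with
  | nil =>
    intro l h
    have : l = [] := by
      have := h.2.1
      simp only [chainVerts, List.length_nil, Finset.range_zero, Finset.biUnion_empty, List.toFinset_eq_empty_iff] at this
      exact this
    subst this
    exact absurd h.2.2.1 (by simp)
  | append_singleton ts' ty ih =>
    intro l h
    have hn : (ts' ++ [ty]).length = ts'.length + 1 := by simp
    have hty : cellTy (ts' ++ [ty]) ts'.length = ty := cellTy_append_length ts' ty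
    have hlast : lastQ (ts' ++ [ty]) = vtx ts'.length ty.qIdx := by
      simp only [lastQ, hn, Nat.add_sub_cancel, hty]
    rw [hlast] at h
    rcases eq_or_ne ts' [] with rfl | hne
    · -- a single cell: strip the connector, read off the traversal
      simp only [List.nil_append, List.length_nil, chainVerts_singleton] at h ⊢
      obtain ⟨l', rfl, hl'⟩ := h.exists_eq_cons (p := vtx 0 ty.pIdx) (vtx_ne_conn 0 0 ty.qIdx).symm fun y _ hy => by
        rcases adj_conn_iff.1 hy with ⟨-, rfl⟩ | ⟨hlt, -, -⟩
        · simp [cellTy_eq_getElem]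
        · exact absurd hlt (lt_irrefl 0)
      rw [Finset.erase_insert (conn_not_mem_blockVerts _ _ _)] at hl'
      have hl'' : IsHamPathOn (chainG [ty]) (blockVerts (cellTy [ty] 0) 0) (vtx 0 (cellTy [ty] 0).pIdx)
          (vtx 0 (cellTy [ty] 0).qIdx) l' := by simpa [cellTy_eq_getElem] using hl'
      obtain ⟨k, hk, rfl⟩ := exists_eq_map_getD_of_block (ts := [ty]) (i := 0) (by simp) hl''
      refine ⟨fun _ => k, fun i hi => ?_, ?_⟩
      · simp only [List.length_singleton, Nat.lt_one_iff] at hi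
        subst hi; exact hk
      · rw [show pathOfN [ty] (fun _ => k) = pathOfN ([] ++ [ty]) (fun _ => k) from rfl, pathOfN_append]
        simp [segment, cellTy_eq_getElem, pathOfN_nil]
    · -- split at the new connector
      have hpos : 0 < ts'.length := List.length_pos_of_ne_nil hne
      obtain ⟨l₁, l₂, x, y, rfl, h₁, h₂, hx, hy⟩ := h.split (A := chainVerts ts') (B := blockVerts ty ts'.length)
        (c := conn ts'.length) (fun v => mem_chainVerts_append) (disjoint_chainVerts_blockVerts ts' ty)
        (fun h => absurd (conn_mem_chainVerts_iff.1 h) (lt_irrefl _)) (conn_not_mem_blockVerts _ _ _)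
        (conn_mem_chainVerts hpos) (vtx_mem_blockVerts_iff.2 ⟨rfl, ty.pIdx_mem.2⟩)
        fun a ha b hb => not_adj_chainVerts_blockVerts ha hb
      -- the end `x` of the first piece is the old `lastQ`
      have hxV : x ∈ chainVerts ts' := h₁.end_mem
      have hxq : x = lastQ ts' := by
        obtain ⟨i, hi, rfl | ⟨j, -, rfl⟩⟩ := eq_conn_or_eq_vtx_of_mem hxV
        · exact absurd hx (not_adj_conn_conn _ _)
        · rcases adj_vtx_conn_iff.1 hx with ⟨h1, -, -⟩ | ⟨h1, -, h3⟩
          · omega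
          · have hi' : i = ts'.length - 1 := by omega
            subst hi'
            rw [lastQ_eq_of_ne_nil hne, h3, cellTy_append_left (by omega)]
      subst hxq
      -- the start `y` of the second piece is the entry corner
      have hyV : y ∈ blockVerts ty ts'.length := h₂.start_mem
      have hyp : y = vtx ts'.length ty.pIdx := by
        obtain ⟨j, -, rfl⟩ := mem_blockVerts.1 hyV
        rcases adj_conn_iff.1 hy with ⟨-, h⟩ | ⟨-, -, h⟩
        · rw [h, hty]
        · exact absurd (vtx_inj.1 h).1 (by omega)
      subst hyp
      -- first piece: induction hypothesis in the old chain
      have h₁' : IsHamPathOn (chainG ts') (chainVerts ts') (conn 0) (lastQ ts') l₁ :=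
        h₁.mono fun a ha b hb hab => (adj_append_iff_of_mem ha hb).1 hab
      obtain ⟨τ', hτ', rfl⟩ := ih h₁'
      -- second piece: a traversal of the new cell
      have h₂' : IsHamPathOn (chainG (ts' ++ [ty])) (blockVerts (cellTy (ts' ++ [ty]) ts'.length) ts'.length)
          (vtx ts'.length (cellTy (ts' ++ [ty]) ts'.length).pIdx) (vtx ts'.length (cellTy (ts' ++ [ty]) ts'.length).qIdx) l₂ := by
        rw [hty]; exact h₂
      obtain ⟨k, hk, rfl⟩ := exists_eq_map_getD_of_block (by simp) h₂'
      rw [hty] at hk ⊢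
      refine ⟨fun i => if i < ts'.length then τ' i else k, fun i hi => ?_, ?_⟩
      · rw [hn] at hi
        dsimp only
        rcases Nat.lt_or_ge i ts'.length with hlt | hge
        · rw [if_pos hlt, cellTy_append_left hlt]; exact hτ' i hlt
        · obtain rfl : i = ts'.length := by omega
          rw [if_neg (lt_irrefl _), hty]; exact hk
      · rw [pathOfN_append, if_neg (lt_irrefl _), pathOfN_congr (τ' := τ') fun i hi => if_pos hi]
        rfl

/-! ### Injectivity of the canonical paths -/

/-- A traversal has as many vertices as its cell. [folklore] -/
theorem length_getD_travs {ty : CellTy} {k : ℕ} (hk : k < ty.ntrav) : (ty.travs.getD k []).length = ty.vertList.length := by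
  have h := ((ty.isHamPathOn_iff_mem_travs _).2 (getD_mem_travs hk)).length_eq
  rw [h, CellTy.verts, List.toFinset_card_of_nodup ty.vertList_nodup]

/-- The length of a segment. [folklore] -/
theorem length_segment {ty : CellTy} (i : ℕ) {k : ℕ} (hk : k < ty.ntrav) : (segment ty i k).length = ty.vertList.length + 1 := by
  rw [segment, List.length_cons, List.length_map, length_getD_travs hk]

/-- The length of a canonical path does not depend on the (valid) traversal indices. [folklore] -/
theorem length_pathOfN_eq : ∀ (ts : List CellTy) {τ τ' : ℕ → ℕ}, (∀ i < ts.length, τ i < (cellTy ts i).ntrav) →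
    (∀ i < ts.length, τ' i < (cellTy ts i).ntrav) → (pathOfN ts τ).length = (pathOfN ts τ').length := by
  intro ts
  induction ts using List.reverseRecOn with
  | nil => intros; rw [pathOfN_nil, pathOfN_nil]
  | append_singleton ts' ty ih =>
    intro τ τ' hτ hτ'
    have hn : (ts' ++ [ty]).length = ts'.length + 1 := by simp
    have hty : cellTy (ts' ++ [ty]) ts'.length = ty := cellTy_append_length ts' ty
    have h1 : τ ts'.length < ty.ntrav := by have := hτ ts'.length (by simp); rwa [hty] at this
    have h2 : τ' ts'.length < ty.ntrav := by have := hτ' ts'.length (by simp); rwa [hty] at this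
    rw [pathOfN_append, pathOfN_append, List.length_append, List.length_append, length_segment _ h1,
      length_segment _ h2,
      ih (fun i hi => by have := hτ i (by rw [hn]; omega); rwa [cellTy_append_left hi] at this)
        (fun i hi => by have := hτ' i (by rw [hn]; omega); rwa [cellTy_append_left hi] at this)]

/-- **Distinct valid index vectors give distinct paths.** [folklore] -/
theorem pathOfN_injective : ∀ (ts : List CellTy) {τ τ' : ℕ → ℕ}, (∀ i < ts.length, τ i < (cellTy ts i).ntrav) →
    (∀ i < ts.length, τ' i < (cellTy ts i).ntrav) → pathOfN ts τ = pathOfN ts τ' → ∀ i < ts.length, τ i = τ' i := by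
  intro ts
  induction ts using List.reverseRecOn with
  | nil => intro _ _ _ _ _ i hi; exact absurd hi (Nat.not_lt_zero i)
  | append_singleton ts' ty ih =>
    intro τ τ' hτ hτ' h i hi
    have hn : (ts' ++ [ty]).length = ts'.length + 1 := by simp
    have hty : cellTy (ts' ++ [ty]) ts'.length = ty := cellTy_append_length ts' ty
    have hτ₀ : ∀ i < ts'.length, τ i < (cellTy ts' i).ntrav := fun i hi => by
      have := hτ i (by rw [hn]; omega); rwa [cellTy_append_left hi] at this
    have hτ₀' : ∀ i < ts'.length, τ' i < (cellTy ts' i).ntrav := fun i hi => by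
      have := hτ' i (by rw [hn]; omega); rwa [cellTy_append_left hi] at this
    have h1 := hτ ts'.length (by simp); have h2 := hτ' ts'.length (by simp)
    rw [hty] at h1 h2
    rw [pathOfN_append, pathOfN_append] at h
    obtain ⟨hpre, hseg⟩ := List.append_inj h (length_pathOfN_eq ts' hτ₀ hτ₀')
    rw [hn] at hi
    rcases Nat.lt_or_ge i ts'.length with hlt | hge
    · exact ih hτ₀ hτ₀' hpre i hlt
    · obtain rfl : i = ts'.length := by omega
      simp only [segment, List.cons.injEq, true_and] at hseg
      have hmap := (List.map_injective_iff.2 (vtx_injective ts'.length)) hseg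
      rw [List.getD_eq_getElem _ _ (by rw [ty.length_travs]; exact h1),
        List.getD_eq_getElem _ _ (by rw [ty.length_travs]; exact h2)] at hmap
      exact (ty.travs_nodup.getElem_inj_iff).1 hmap

/-! ### Which cell edges a canonical path uses -/

/-- The vertices of a canonical path are the chain vertices. [folklore] -/
theorem mem_pathOfN_iff {ts : List CellTy} {τ : ℕ → ℕ} (hτ : ∀ i < ts.length, τ i < (cellTy ts i).ntrav) {v : ℕ} :
    v ∈ pathOfN ts τ ↔ v ∈ chainVerts ts := by
  rcases eq_or_ne ts [] with rfl | hne
  · simp [pathOfN_nil, chainVerts]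
  · rw [← List.mem_toFinset, (isHamPathOn_pathOfN ts hne τ hτ).2.1]

/-- `Uses` of an appended list when the edge avoids the second part. [folklore] -/
theorem uses_append_left_iff {l₁ l₂ : List ℕ} {e : ℕ × ℕ} (h1 : e.1 ∉ l₂) (h2 : e.2 ∉ l₂) :
    Uses (l₁ ++ l₂) e ↔ Uses l₁ e := by
  unfold Uses
  rw [show l₁ ++ l₂ = [] ++ l₁ ++ l₂ from rfl,
    pair_infix_inner_iff (A := []) (by simpa using h1) (by simpa using h2),
    pair_infix_inner_iff (A := []) (by simpa using h2) (by simpa using h1)]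

/-- `Uses` of an appended list when the edge avoids the first part. [folklore] -/
theorem uses_append_right_iff {l₁ l₂ : List ℕ} {e : ℕ × ℕ} (h1 : e.1 ∉ l₁) (h2 : e.2 ∉ l₁) :
    Uses (l₁ ++ l₂) e ↔ Uses l₂ e := by
  unfold Uses
  rw [show l₁ ++ l₂ = l₁ ++ l₂ ++ [] by rw [List.append_nil],
    pair_infix_inner_iff (C := []) (by simpa using h1) (by simpa using h2),
    pair_infix_inner_iff (C := []) (by simpa using h2) (by simpa using h1)]

/-- `Uses` of a segment: the connector is not an end of a cell edge. [folklore] -/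
theorem uses_segment_vtx_iff (ty : CellTy) (i k : ℕ) (a b : Fin 16) :
    Uses (segment ty i k) (vtx i a, vtx i b) ↔ Uses (ty.travs.getD k []) (a, b) := by
  rw [segment, show conn i :: (ty.travs.getD k []).map (vtx i) = [conn i] ++ (ty.travs.getD k []).map (vtx i) from rfl,
    uses_append_right_iff (by simp [vtx_ne_conn]) (by simp [vtx_ne_conn])]
  exact uses_map_iff (vtx_injective i) (e := (a, b))

/-- **The cell edges used by a canonical path are read off the cell's traversal.** [folklore] -/
theorem uses_pathOfN_vtx_iff : ∀ (ts : List CellTy) {τ : ℕ → ℕ}, (∀ i < ts.length, τ i < (cellTy ts i).ntrav) →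
    ∀ {i : ℕ}, i < ts.length → ∀ (a b : Fin 16),
      (Uses (pathOfN ts τ) (vtx i a, vtx i b) ↔ Uses ((cellTy ts i).travs.getD (τ i) []) (a, b)) := by
  intro ts
  induction ts using List.reverseRecOn with
  | nil => intro _ _ i hi; exact absurd hi (Nat.not_lt_zero i)
  | append_singleton ts' ty ih =>
    intro τ hτ i hi a b
    have hn : (ts' ++ [ty]).length = ts'.length + 1 := by simp
    have hty : cellTy (ts' ++ [ty]) ts'.length = ty := cellTy_append_length ts' ty
    have hτ₀ : ∀ i < ts'.length, τ i < (cellTy ts' i).ntrav := fun i hi => by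
      have := hτ i (by rw [hn]; omega); rwa [cellTy_append_left hi] at this
    rw [pathOfN_append]
    rw [hn] at hi
    rcases Nat.lt_or_ge i ts'.length with hlt | hge
    · rw [uses_append_left_iff, ih hτ₀ hlt, cellTy_append_left hlt]
      all_goals simp only [segment, List.mem_cons, List.mem_map, not_or, not_exists, not_and]
      all_goals exact ⟨vtx_ne_conn _ _ _, fun j _ h => absurd (vtx_inj.1 h).1 (by omega)⟩
    · obtain rfl : i = ts'.length := by omega
      rw [uses_append_right_iff, uses_segment_vtx_iff, hty]
      all_goals rw [mem_pathOfN_iff hτ₀]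
      all_goals exact fun h => absurd (vtx_mem_chainVerts_iff.1 h).1 (lt_irrefl _)

/-! ### Counting -/

/-- Every cell has at most four traversals. [folklore] -/
theorem ntrav_le_four (ty : CellTy) : ty.ntrav ≤ 4 := by cases ty <;> decide

/-- A traversal-index vector on `Fin n`, extended by `0`. [folklore] -/
def extN {n : ℕ} (σ : Fin n → Fin 4) (i : ℕ) : ℕ := if h : i < n then (σ ⟨i, h⟩).val else 0

/-- **Valid index vectors**: in cell `i` the index is below the number of traversals. [folklore] -/
def ValidIdx (ts : List CellTy) (σ : Fin ts.length → Fin 4) : Prop := ∀ i : Fin ts.length, (σ i).val < (cellTy ts i).ntrav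

/-- Validity is decidable. [folklore] -/
instance (ts : List CellTy) : DecidablePred (ValidIdx ts) := fun _ => by unfold ValidIdx; infer_instance

/-- The extension of a valid vector is valid below the length. [folklore] -/
theorem extN_lt {ts : List CellTy} {σ : Fin ts.length → Fin 4} (hσ : ValidIdx ts σ) :
    ∀ i < ts.length, extN σ i < (cellTy ts i).ntrav := fun i hi => by
  simp only [extN, dif_pos hi]; exact hσ ⟨i, hi⟩

/-- **The Hamiltonian `s`–`t` paths of the chain with a property are counted by valid index vectors.**
[folklore] -/
theorem ncard_isHamPathOn_eq_card {ts : List CellTy} (hts : ts ≠ []) (Q : List ℕ → Prop) [DecidablePred Q] :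
    {l | IsHamPathOn (chainG ts) (chainVerts ts) (conn 0) (lastQ ts) l ∧ Q l}.ncard =
      (Finset.univ.filter fun σ : Fin ts.length → Fin 4 => ValidIdx ts σ ∧ Q (pathOfN ts (extN σ))).card := by
  classical
  have hset : {l | IsHamPathOn (chainG ts) (chainVerts ts) (conn 0) (lastQ ts) l ∧ Q l} =
      (fun σ : Fin ts.length → Fin 4 => pathOfN ts (extN σ)) ''
        ↑(Finset.univ.filter fun σ : Fin ts.length → Fin 4 => ValidIdx ts σ ∧ Q (pathOfN ts (extN σ))) := by
    ext l
    simp only [Set.mem_setOf_eq, Set.mem_image, Finset.coe_filter, Finset.mem_univ, true_and]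
    constructor
    · rintro ⟨hham, hQ⟩
      obtain ⟨τ, hτ, rfl⟩ := exists_eq_pathOfN ts hham
      refine ⟨fun i => ⟨τ i, lt_of_lt_of_le (hτ i i.isLt) (ntrav_le_four _)⟩, ⟨fun i => hτ i i.isLt, ?_⟩, ?_⟩
      all_goals rw [pathOfN_congr (τ' := τ) fun i hi => by simp [extN, dif_pos hi]]
      exact hQ
    · rintro ⟨σ, ⟨hσ, hQ⟩, rfl⟩
      exact ⟨isHamPathOn_pathOfN ts hts _ (extN_lt hσ), hQ⟩
  have hinj : Set.InjOn (fun σ : Fin ts.length → Fin 4 => pathOfN ts (extN σ))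
      ↑(Finset.univ.filter fun σ : Fin ts.length → Fin 4 => ValidIdx ts σ ∧ Q (pathOfN ts (extN σ))) := by
    intro σ hσ σ' hσ' h
    simp only [Finset.coe_filter, Finset.mem_univ, true_and, Set.mem_setOf_eq] at hσ hσ'
    funext i
    have := pathOfN_injective ts (extN_lt hσ.1) (extN_lt hσ'.1) h i i.isLt
    simp only [extN, dif_pos i.isLt] at this
    exact Fin.ext this
  rw [hset, hinj.ncard_image, Set.ncard_coe_finset]

/-- **The constrained Hamiltonian-path counts of the chain are numbers of valid index vectors.**
[folklore] -/
theorem hamCountRF_chainG_eq_card {ts : List CellTy} (hts : ts ≠ []) (R F : Finset (ℕ × ℕ)) :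
    hamCountRF (chainG ts) (chainVerts ts) (conn 0) (lastQ ts) R F =
      (Finset.univ.filter fun σ : Fin ts.length → Fin 4 => ValidIdx ts σ ∧
        ((∀ e ∈ R, Uses (pathOfN ts (extN σ)) e) ∧ ∀ e ∈ F, ¬ Uses (pathOfN ts (extN σ)) e)).card := by
  rw [hamCountRF, hamSetRF]
  exact ncard_isHamPathOn_eq_card hts fun l => (∀ e ∈ R, Uses l e) ∧ ∀ e ∈ F, ¬ Uses l e

/-- The unconstrained count of the chain is the number of valid index vectors. [folklore] -/
theorem hamCount_chainG_eq_card {ts : List CellTy} (hts : ts ≠ []) :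
    hamCount (chainG ts) (chainVerts ts) (conn 0) (lastQ ts) =
      (Finset.univ.filter fun σ : Fin ts.length → Fin 4 => ValidIdx ts σ).card := by
  rw [hamCount_eq, hamCountRF_chainG_eq_card hts]
  congr 1
  ext σ
  simp

/-- The start `conn 0` is a chain vertex (nonempty chain). [folklore] -/
theorem conn_zero_mem_chainVerts {ts : List CellTy} (hts : ts ≠ []) : conn 0 ∈ chainVerts ts :=
  conn_mem_chainVerts (List.length_pos_of_ne_nil hts)

/-- The end `lastQ` is a chain vertex (nonempty chain). [folklore] -/
theorem lastQ_mem_chainVerts {ts : List CellTy} (hts : ts ≠ []) : lastQ ts ∈ chainVerts ts := by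
  have hpos := List.length_pos_of_ne_nil hts
  exact vtx_mem_chainVerts_iff.2 ⟨by omega, (cellTy ts _).pIdx_mem.2⟩

/-- `conn 0 ≠ lastQ`. [folklore] -/
theorem conn_zero_ne_lastQ (ts : List CellTy) : conn 0 ≠ lastQ ts := (vtx_ne_conn _ _ _).symm

end GridCell

end Literature.Combinatorics.SimpleGraph
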